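/-
Origin: expansion seat `planner-pub-hodgecm-toy-g2-0`, handover #35 2026-08-18T10:29:23Z (`HOME/pub-hodgecm-toy-g2/lean/ToyG2/G4FromSplits.lean`, md5 cc8508aa, 50 lines);
landed by the gen-7 packager in gate run 28 as `HodgeCM/Model/ToyG2/G4FromSplits.lean` (import ^import ToyG2\.→import HodgeCM.Model.ToyG2. ×2).
-/
/-
# HodgeCM.Model.ToyG2.G4FromSplits — the G4 witness from weight-stable rational complements (the generation-3 target in one line)

Generation 2 of the `pub-hodgecm-toy` lineage (seat `planner-pub-hodgecm-toy-g2-0`), DESIGN.md §9·UPDATE 10:30Z.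
Composition of `HodgeRieszSplit` (#34: Hodge–Riesz from a split) with `G4Witness` (#31 v2) and `RadicalProdStep` (#33):

* `SplitInput` — the single remaining input of the G4 programme: every good object admits a rational complement of the right radical of
  its trace pairing `⋀⁴ × ⋀^{2(dim−2)} → ℚ` whose complexification is stable under the weight operators (semisimplicity of the toy Hodge
  structures; proof route E1–E4 in DESIGN.md §9·UPDATE 10:30Z);
* `toyUniverse₃_modelAxioms_of_splitInput : SplitInput → (toyUniverse₃ d t).ModelAxioms` (all 28 model axioms);
* `g4_witness_of_splitInput : SplitInput → ∃ U, U.ModelAxioms ∧ U.RealisationExistsPerL ∧ U.RealisationExistsFace` (referee A, G4);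
* `endState₃_of_splitInput : SplitInput → PerL ∧ PeriodThmF ∧ W_RK4` in `toyUniverse₃ d t` (`1 ≤ d`, `t² = 16`).
-/
import Mathlib
import Summits.HodgeConjecture.HodgeCM.Model.ToyG2.G4Witness
import Summits.HodgeConjecture.HodgeCM.Model.ToyG2.HodgeRieszSplit

/-! PORT of `HodgeCM/Model/ToyG2/G4FromSplits.lean` (HodgeCMPerL run 82) — verbatim mechanical port; provenance in the PORT header line. -/

namespace HodgeCM.ToyG2

open HodgeCM.Toy HodgeCM.Toy.CMPresentation
open Literature.AlgebraicGeometry.Motives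
open HodgeCM.ToyG2.ThetaUiso

noncomputable section

/-- **the remaining input of the G4 programme**: weight-stable rational complements of the right radicals for all good objects -/
def SplitInput : Prop := ∀ X : Obj₂, X.Good → ∃ W, RightSplit X (2 * (X.dim - 2)) W

/-- (Ported verbatim from the HodgeCMPerL package; no docstring in the source.) -/
theorem hodgeRiesz_of_splitInput (h : SplitInput) : ∀ X : Obj₂, X.Good → HodgeRiesz X := hodgeRiesz_of_splits h

/-- (Ported verbatim from the HodgeCMPerL package; no docstring in the source.) -/
theorem hrProdStep_of_splitInput (h : SplitInput) : HRProdStep :=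
  fun X₁ X₂ h₁ h₂ _ _ => hodgeRiesz_of_splits h (X₁.prod X₂) (h₁.prod h₂)

/-- all 28 model axioms for `toyUniverse₃ d t` from `SplitInput` -/
theorem toyUniverse₃_modelAxioms_of_splitInput (d t : ℚ) (h : SplitInput) : (toyUniverse₃ d t).ModelAxioms :=
  toyUniverse₃_modelAxioms_of_hodgeRiesz d t (hodgeRiesz_of_splits h)

/-- **G4 from `SplitInput`**: a universe satisfying `ModelAxioms` together with both realisation statements -/
theorem g4_witness_of_splitInput (h : SplitInput) :
    ∃ U : Universe, U.ModelAxioms ∧ U.RealisationExistsPerL ∧ U.RealisationExistsFace :=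
  g4_witness_of_hodgeRiesz (hodgeRiesz_of_splits h)

/-- the in-model end state from `SplitInput` -/
theorem endState₃_of_splitInput (d t : ℚ) (hd : (1 : ℚ) ≤ d) (ht : t ^ 2 = 16) (h : SplitInput) :
    (toyUniverse₃ d t).PerL ∧ (toyUniverse₃ d t).PeriodThmF ∧ (toyUniverse₃ d t).W_RK4 :=
  endState₃_of_hrProdStep d t hd ht (hrProdStep_of_splitInput h)

end

end HodgeCM.ToyG2
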